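import Mathlib
import Literature.Probability.LatticeModels.ProdBernoulliIndependence
import Literature.Probability.Percolation.ConditionalPositiveAssociation
import Literature.Probability.Percolation.ConditionalPositiveAssociationProofs
import Literature.Probability.Percolation.TwoClusterConditionalAssociation
import Literature.Probability.Percolation.PercolationProofs
import Literature.Probability.Percolation.ClusterBoundary
import HarnessLib

/-!
# `NoHeavyLowerTail` (stmt-CriticalPhenomena-4575), one-cut line — GENERAL TERMINAL SEPARATION
# (Kozma–Nitzan Lemma 1(i) for a vertex `a`, a separating set `T`, a conjunctive increasing event of
# `C(a)` and a conjunctive decreasing event on the clusters of `T`), unconditional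

With `μ = prodBernoulli w` on `Fin n`, a vertex `a`, finite vertex sets `T, O` and a finite set `P` of
pairs `(t, u)` with `t ∈ T`, put `E = {a ↔ v ∀ v ∈ O}` (increasing, determined by the cluster of `a`),
`D = {a ↮ T}`, `Q = {t ↮ u ∀ (t,u) ∈ P}` (decreasing, determined by the clusters of `T`).  Then

  `μ(E ∩ D) · μ(D ∩ Q) ≤ μ(D) · μ(E ∩ D ∩ Q)`          (`terminalSeparation_general`)

i.e. `P(E | a ↮ T) ≤ P(E | a ↮ T, Q)`: extra decreasing conditioning on the OTHER clusters raises the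
conditional probability of an increasing event of `C(a)` (Kozma–Nitzan arXiv:2401.12397 Lemma 1(i), p. 5;
van den Berg–Häggström–Kahn 2006 Thms 1.2–1.4).  The tree's `stub_terminalSeparation` (crux stmt-4574) is
the case `O = {o}`, `P = {(t,t') : t ≠ t' ∈ T}`; this file repeats its argument (adapted from
`PercNearOneGluingNearOneGluingTerminalSeparation.lean`, whose lemmas are private) for general `O, P`:
condition on the vertex cluster `K = C(a)`; off `K` the configuration is fresh
(`prodBernoulli_real_inter_of_determinedBy`), so `G(C_a) = μ(Q holds using only the edges avoiding K)` is an
increasing function of the edge cluster, as is `F(C_a) = 1_E`; BHK 2006 Thm 1.3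
(`BHK2006_clusterConditionalPositiveAssociation_holds`) applied to `F, G` and the three set integrals
identified by summing over `{C(a) = K}`.  These are the "(T) rows" of the one-cut certificate searches
(prim-cplus-engine, ONE-CUT-STRUCTURE.md).
-/

namespace Summit.CriticalPhenomena.PercolationContinuityZ3.Theorems

open scoped BigOperators Classical
open MeasureTheory Set
open Literature.Probability.LatticeModels (prodBernoulli prodBernoulli_real_inter_of_determinedBy)
open Literature.Probability.Percolation

variable {n : ℕ}

namespace GeneralTerminalSeparation

/-! ### The decreasing event `Q_P = {t ↮ u ∀ (t,u) ∈ P}` -/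

/-- `Q_P` is decreasing. [folklore] -/
theorem isLowerSet_pairSep (P : Finset (Fin n × Fin n)) :
    IsLowerSet {ω : BondConfig (Fin n) | ∀ p ∈ P, ω ∉ openConn p.1 p.2} := by
  intro ω ω' hle hω p hp hconn
  exact hω p hp (isUpperSet_openConn p.1 p.2 hle hconn)

/-- `edgesTouching` is monotone. [folklore] -/
theorem edgesTouching_mono' {K K' : Set (Fin n)} (h : K ⊆ K') :
    edgesTouching K ⊆ edgesTouching K' :=
  fun _ ⟨v, hve, hvK⟩ => ⟨v, hve, h hvK⟩

/-- For a decreasing event `Q`, "`Q` holds using only the edges avoiding `K`" is monotone in `K`.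
[folklore] -/
theorem sepOff_mono' {Q : Set (BondConfig (Fin n))} (hQ : IsLowerSet Q) {K K' : Set (Fin n)}
    (h : K ⊆ K') :
    {ω : BondConfig (Fin n) | ω \ edgesTouching K ∈ Q} ⊆ {ω | ω \ edgesTouching K' ∈ Q} :=
  fun _ hω => hQ (sdiff_subset_sdiff_right (edgesTouching_mono' h)) hω

/-- The vertex set of an edge set is monotone. [folklore] -/
theorem vset_mono' (a : Fin n) {W W' : Set (Sym2 (Fin n))} (h : W ⊆ W') :
    {v | v = a ∨ ∃ e ∈ W, v ∈ e} ⊆ {v | v = a ∨ ∃ e ∈ W', v ∈ e} :=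
  fun _ hv => hv.imp id fun ⟨e, he, hve⟩ => ⟨e, h he, hve⟩

/-- `G(W) = μ(Q off the vertex set of W)` is increasing in `W` (for `Q` decreasing). [folklore] -/
theorem monotone_G' (w : Sym2 (Fin n) → unitInterval) {Q : Set (BondConfig (Fin n))}
    (hQ : IsLowerSet Q) (a : Fin n) :
    Monotone fun W : Set (Sym2 (Fin n)) =>
      (prodBernoulli w).real {ω | ω \ edgesTouching {v | v = a ∨ ∃ e ∈ W, v ∈ e} ∈ Q} :=
  fun _ _ h => measureReal_mono (sepOff_mono' hQ (vset_mono' a h))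

/-- The increasing function `F_O(W) = 1{every v ∈ O is a or lies on an edge of W}`. [folklore] -/
theorem monotone_F' (a : Fin n) (O : Finset (Fin n)) :
    Monotone fun W : Set (Sym2 (Fin n)) =>
      (if ∀ v ∈ O, v = a ∨ ∃ e ∈ W, v ∈ e then (1 : ℝ) else 0) := by
  intro W W' h
  simp only
  by_cases hW : ∀ v ∈ O, v = a ∨ ∃ e ∈ W, v ∈ e
  · rw [if_pos hW, if_pos (fun v hv => (hW v hv).imp id fun ⟨e, he, hve⟩ => ⟨e, h he, hve⟩)]
  · rw [if_neg hW]; split_ifs <;> norm_num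

/-! ### On the event `{C(a) = K}` -/

/-- The vertex set of the edge cluster of `a` is the vertex cluster of `a`. [folklore] -/
theorem vset_openEdgeCluster' (a : Fin n) (ω : BondConfig (Fin n)) :
    {v | v = a ∨ ∃ e ∈ openEdgeCluster ω a, v ∈ e} = openCluster ω a := by
  ext v
  exact (reachable_iff_exists_mem_openEdgeCluster ω a v).symm

/-- On `{C(a) = K}`, `G(C_a ω) = μ(Q off K)`. [folklore] -/
theorem G_openEdgeCluster' (w : Sym2 (Fin n) → unitInterval) (Q : Set (BondConfig (Fin n)))
    {a : Fin n} {K : Finset (Fin n)} {ω : BondConfig (Fin n)} (hω : ω ∈ clusterIs a K) :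
    (prodBernoulli w).real
        {ω' | ω' \ edgesTouching {v | v = a ∨ ∃ e ∈ openEdgeCluster ω a, v ∈ e} ∈ Q} =
      (prodBernoulli w).real {ω' | ω' \ edgesTouching (↑K : Set (Fin n)) ∈ Q} := by
  rw [vset_openEdgeCluster', mem_clusterIs.1 hω]

/-- On `{C(a) = K}`: `a ↔ b` iff `b ∈ K`. [folklore] -/
theorem mem_openConn_iff_of_mem' {a b : Fin n} {K : Finset (Fin n)} {ω : BondConfig (Fin n)}
    (hω : ω ∈ clusterIs a K) : ω ∈ openConn a b ↔ b ∈ K := by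
  rw [← Finset.mem_coe, ← mem_clusterIs.1 hω]
  rfl

/-- On `{C(a) = K}`, `F_O(C_a ω) = [O ⊆ K]`. [folklore] -/
theorem F_openEdgeCluster' {a : Fin n} (O : Finset (Fin n)) {K : Finset (Fin n)}
    {ω : BondConfig (Fin n)} (hω : ω ∈ clusterIs a K) :
    (if ∀ v ∈ O, v = a ∨ ∃ e ∈ openEdgeCluster ω a, v ∈ e then (1 : ℝ) else 0) =
      if ∀ v ∈ O, v ∈ K then 1 else 0 := by
  have key : (∀ v ∈ O, v = a ∨ ∃ e ∈ openEdgeCluster ω a, v ∈ e) ↔ ∀ v ∈ O, v ∈ K := by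
    refine forall₂_congr fun v _ => ?_
    rw [← reachable_iff_exists_mem_openEdgeCluster ω a v]
    exact mem_openConn_iff_of_mem' hω
  simp only [key]

/-- On `{C(a) = K}`: `a ↮ T` iff `T` misses `K`. [folklore] -/
theorem disconn_iff_of_mem' {a : Fin n} (T : Finset (Fin n)) {K : Finset (Fin n)}
    {ω : BondConfig (Fin n)} (hω : ω ∈ clusterIs a K) :
    (∀ t ∈ T, ω ∉ openConn a t) ↔ ∀ t ∈ T, t ∉ K := by
  refine forall₂_congr fun t _ => ?_
  rw [mem_openConn_iff_of_mem' hω]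

/-- `{a ↮ T} ∩ {C(a) = K}` is `{C(a) = K}` if `T` misses `K`, and empty otherwise. [folklore] -/
theorem disconn_inter_clusterIs' (a : Fin n) (T K : Finset (Fin n)) :
    {ω | ∀ t ∈ T, ω ∉ openConn a t} ∩ clusterIs a K =
      if (∀ t ∈ T, t ∉ K) then clusterIs a K else ∅ := by
  ext ω
  split_ifs with h
  · exact ⟨fun hω => hω.2, fun hω => ⟨(disconn_iff_of_mem' T hω).2 h, hω⟩⟩
  · simp only [mem_inter_iff, mem_setOf_eq, mem_empty_iff_false, iff_false, not_and]
    exact fun hD hω => h ((disconn_iff_of_mem' T hω).1 hD)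

/-- `E_O ∩ S ∩ {C(a) = K}` is `S ∩ {C(a) = K}` if `O ⊆ K`, and empty otherwise. [folklore] -/
theorem connAll_inter_inter_clusterIs' (a : Fin n) (O K : Finset (Fin n))
    (S : Set (BondConfig (Fin n))) :
    {ω | ∀ v ∈ O, ω ∈ openConn a v} ∩ (S ∩ clusterIs a K) =
      if (∀ v ∈ O, v ∈ K) then S ∩ clusterIs a K else ∅ := by
  ext ω
  split_ifs with ho
  · exact ⟨fun h => h.2, fun h => ⟨fun v hv => (mem_openConn_iff_of_mem' h.2).2 (ho v hv), h⟩⟩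
  · simp only [mem_inter_iff, mem_setOf_eq, mem_empty_iff_false, iff_false, not_and]
    exact fun hE _ hω => ho fun v hv => (mem_openConn_iff_of_mem' hω).1 (hE v hv)

/-- An open walk none of whose vertices lies in `K` is open in `ω ∖ edgesTouching K`. [folklore] -/
theorem reachable_sdiff_edgesTouching' {ω : BondConfig (Fin n)} {K : Set (Fin n)}
    {u v : Fin n} (p : (openGraph ω).Walk u v) (hp : ∀ x ∈ p.support, x ∉ K) :
    (openGraph (ω \ edgesTouching K)).Reachable u v := by
  refine ⟨p.transfer (openGraph (ω \ edgesTouching K)) fun e he => ?_⟩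
  have h1 : e ∈ (openGraph ω).edgeSet := p.edges_subset_edgeSet he
  simp only [openGraph, SimpleGraph.edgeSet_fromEdgeSet, mem_sdiff, mem_setOf_eq, edgesTouching,
    not_exists, not_and] at h1 ⊢
  exact ⟨⟨h1.1, fun z hz hzK => hp z (SimpleGraph.Walk.mem_support_of_mem_edges he hz) hzK⟩,
    h1.2⟩

/-- On `{C(a) = K}` with `T` missing `K` and every pair of `P` starting in `T`: `Q_P` holds iff it
holds using only the edges avoiding `K` (an open path from a vertex of `T` cannot touch `K = C(a)`,
since `a ↮ T`). [folklore] -/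
theorem pairSep_iff_off_of_mem' {a : Fin n} {T K : Finset (Fin n)} {P : Finset (Fin n × Fin n)}
    (hP : ∀ p ∈ P, p.1 ∈ T) {ω : BondConfig (Fin n)}
    (hω : ω ∈ clusterIs a K) (hTK : ∀ t ∈ T, t ∉ K) :
    ω ∈ {ω : BondConfig (Fin n) | ∀ p ∈ P, ω ∉ openConn p.1 p.2} ↔
      ω \ edgesTouching (↑K : Set (Fin n)) ∈
        {ω : BondConfig (Fin n) | ∀ p ∈ P, ω ∉ openConn p.1 p.2} := by
  refine ⟨fun h => isLowerSet_pairSep P (sdiff_subset (s := ω) (t := edgesTouching ↑K)) h,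
    fun h => ?_⟩
  intro p hp hconn
  obtain ⟨q⟩ := (hconn : (openGraph ω).Reachable p.1 p.2)
  refine h p hp (reachable_sdiff_edgesTouching' q fun x hx hxK => ?_)
  have hax : x ∈ openCluster ω a := by rw [mem_clusterIs.1 hω]; exact hxK
  have hat : (openGraph ω).Reachable a p.1 :=
    SimpleGraph.Reachable.trans hax ⟨(q.takeUntil x hx).reverse⟩
  exact hTK p.1 (hP p hp) ((mem_openConn_iff_of_mem' hω).1 hat)

/-- "`Q` holds using only the edges avoiding `K`" is determined by the edges not touching `K`.
[folklore] -/
theorem determinedBy_sepOff' (Q : Set (BondConfig (Fin n))) (K : Set (Fin n)) :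
    DeterminedBy {ω : BondConfig (Fin n) | ω \ edgesTouching K ∈ Q} (edgesTouching K)ᶜ := by
  rw [determinedBy_iff]
  intro ω ω' h
  simp only [mem_setOf_eq, sdiff_eq, h]

/-- Independence of `{C(a) = K}` and "`Q` holds off `K`". [folklore] -/
theorem real_clusterIs_inter_sepOff' (w : Sym2 (Fin n) → unitInterval)
    (Q : Set (BondConfig (Fin n))) (a : Fin n) (K : Finset (Fin n)) :
    (prodBernoulli w).real (clusterIs a K ∩ {ω | ω \ edgesTouching (↑K : Set (Fin n)) ∈ Q}) =
      (prodBernoulli w).real (clusterIs a K) *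
        (prodBernoulli w).real {ω | ω \ edgesTouching (↑K : Set (Fin n)) ∈ Q} := by
  refine prodBernoulli_real_inter_of_determinedBy w
    (edgesTouching (↑K : Set (Fin n))).toFinite.toFinset ?_ ?_ MeasurableSet.of_discrete
    MeasurableSet.of_discrete
  · rw [Set.Finite.coe_toFinset]; exact determinedBy_clusterIs a K
  · rw [Set.Finite.coe_toFinset]; exact determinedBy_sepOff' Q ↑K

/-! ### Set integrals of functions of the cluster -/

/-- A function constant on each `{C(a) = K}` integrates over `S` to `∑_K μ(S ∩ {C(a) = K}) c_K`.
[folklore] -/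
theorem setIntegral_eq_sum_clusterIs' (μ : Measure (BondConfig (Fin n)))
    [IsFiniteMeasure μ] (a : Fin n) (S : Set (BondConfig (Fin n))) (f : BondConfig (Fin n) → ℝ)
    (c : Finset (Fin n) → ℝ) (hf : ∀ K, ∀ ω ∈ clusterIs a K, f ω = c K) :
    ∫ ω in S, f ω ∂μ = ∑ K : Finset (Fin n), μ.real (S ∩ clusterIs a K) * c K := by
  have hS : S = ⋃ K : Finset (Fin n), S ∩ clusterIs a K := by
    ext ω
    simp only [mem_iUnion, mem_inter_iff]
    exact ⟨fun h => ⟨(openCluster ω a).toFinite.toFinset, h, by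
      rw [mem_clusterIs, Set.Finite.coe_toFinset]⟩, fun ⟨_, h, _⟩ => h⟩
  calc ∫ ω in S, f ω ∂μ
      = ∫ ω in ⋃ K : Finset (Fin n), S ∩ clusterIs a K, f ω ∂μ := by rw [← hS]
    _ = ∑ K : Finset (Fin n), ∫ ω in S ∩ clusterIs a K, f ω ∂μ :=
        integral_iUnion_fintype (fun _ => MeasurableSet.of_discrete)
          (fun K K' hKK' => Disjoint.mono inter_subset_right inter_subset_right
            (pairwise_disjoint_clusterIs a hKK'))
          (fun _ => Integrable.of_finite)
    _ = ∑ K : Finset (Fin n), μ.real (S ∩ clusterIs a K) * c K := by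
        refine Finset.sum_congr rfl fun K _ => ?_
        rw [setIntegral_congr_fun MeasurableSet.of_discrete (fun ω hω => hf K ω hω.2),
          setIntegral_const, smul_eq_mul]

/-- Total probability over the values of the cluster. [folklore] -/
theorem measureReal_eq_sum_clusterIs' (μ : Measure (BondConfig (Fin n)))
    [IsFiniteMeasure μ] (a : Fin n) (S : Set (BondConfig (Fin n))) :
    μ.real S = ∑ K : Finset (Fin n), μ.real (S ∩ clusterIs a K) := by
  have h := setIntegral_eq_sum_clusterIs' μ a S (fun _ => (1 : ℝ)) (fun _ => 1) fun _ _ _ => rfl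
  rw [setIntegral_const, smul_eq_mul, mul_one] at h
  rw [h]
  exact Finset.sum_congr rfl fun K _ => mul_one _

section Main

variable (w : Sym2 (Fin n) → unitInterval) (T O : Finset (Fin n)) (a : Fin n)
  {Q : Set (BondConfig (Fin n))}

/-- Termwise: `μ({a ↮ T} ∩ {C(a) = K}) · μ(Q off K) = μ({a ↮ T} ∩ Q ∩ {C(a) = K})`. [folklore] -/
theorem real_disconn_inter_clusterIs_mul'
    (hQ : ∀ (K : Finset (Fin n)) (ω : BondConfig (Fin n)), ω ∈ clusterIs a K →
      (∀ t ∈ T, t ∉ K) → (ω ∈ Q ↔ ω \ edgesTouching (↑K : Set (Fin n)) ∈ Q))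
    (K : Finset (Fin n)) :
    (prodBernoulli w).real ({ω | ∀ t ∈ T, ω ∉ openConn a t} ∩ clusterIs a K) *
        (prodBernoulli w).real {ω | ω \ edgesTouching (↑K : Set (Fin n)) ∈ Q} =
      (prodBernoulli w).real ({ω | ∀ t ∈ T, ω ∉ openConn a t} ∩ Q ∩ clusterIs a K) := by
  rw [inter_right_comm, disconn_inter_clusterIs']
  split_ifs with hTK
  · rw [← real_clusterIs_inter_sepOff']
    congr 1
    ext ω
    exact ⟨fun ⟨hω, hq⟩ => ⟨hω, (hQ K ω hω hTK).2 hq⟩,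
      fun ⟨hω, hq⟩ => ⟨hω, (hQ K ω hω hTK).1 hq⟩⟩
  · simp

/-- `∫_{a ↮ T} G(C_a) dμ = μ({a ↮ T} ∩ Q)`. [folklore] -/
theorem setIntegral_G'
    (hQ : ∀ (K : Finset (Fin n)) (ω : BondConfig (Fin n)), ω ∈ clusterIs a K →
      (∀ t ∈ T, t ∉ K) → (ω ∈ Q ↔ ω \ edgesTouching (↑K : Set (Fin n)) ∈ Q)) :
    ∫ ω in {ω | ∀ t ∈ T, ω ∉ openConn a t},
        (prodBernoulli w).real
          {ω' | ω' \ edgesTouching {v | v = a ∨ ∃ e ∈ openEdgeCluster ω a, v ∈ e} ∈ Q}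
        ∂(prodBernoulli w) =
      (prodBernoulli w).real ({ω | ∀ t ∈ T, ω ∉ openConn a t} ∩ Q) := by
  rw [setIntegral_eq_sum_clusterIs' (prodBernoulli w) a {ω | ∀ t ∈ T, ω ∉ openConn a t} _
      (fun K => (prodBernoulli w).real {ω' | ω' \ edgesTouching (↑K : Set (Fin n)) ∈ Q})
      (fun K ω hω => G_openEdgeCluster' w Q hω),
    measureReal_eq_sum_clusterIs' (prodBernoulli w) a ({ω | ∀ t ∈ T, ω ∉ openConn a t} ∩ Q)]
  exact Finset.sum_congr rfl fun K _ => real_disconn_inter_clusterIs_mul' w T a hQ K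

/-- `∫_{a ↮ T} F_O(C_a) dμ = μ(E_O ∩ {a ↮ T})`. [folklore] -/
theorem setIntegral_F' :
    ∫ ω in {ω | ∀ t ∈ T, ω ∉ openConn a t},
        (if ∀ v ∈ O, v = a ∨ ∃ e ∈ openEdgeCluster ω a, v ∈ e then (1 : ℝ) else 0)
        ∂(prodBernoulli w) =
      (prodBernoulli w).real ({ω | ∀ v ∈ O, ω ∈ openConn a v} ∩
        {ω | ∀ t ∈ T, ω ∉ openConn a t}) := by
  rw [setIntegral_eq_sum_clusterIs' (prodBernoulli w) a {ω | ∀ t ∈ T, ω ∉ openConn a t} _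
      (fun K => if (∀ v ∈ O, v ∈ K) then (1 : ℝ) else 0)
      (fun K ω hω => F_openEdgeCluster' O hω),
    measureReal_eq_sum_clusterIs' (prodBernoulli w) a
      ({ω | ∀ v ∈ O, ω ∈ openConn a v} ∩ {ω | ∀ t ∈ T, ω ∉ openConn a t})]
  refine Finset.sum_congr rfl fun K _ => ?_
  rw [inter_assoc, connAll_inter_inter_clusterIs']
  split_ifs <;> simp

/-- `∫_{a ↮ T} F_O(C_a) G(C_a) dμ = μ(E_O ∩ ({a ↮ T} ∩ Q))`. [folklore] -/
theorem setIntegral_F_mul_G'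
    (hQ : ∀ (K : Finset (Fin n)) (ω : BondConfig (Fin n)), ω ∈ clusterIs a K →
      (∀ t ∈ T, t ∉ K) → (ω ∈ Q ↔ ω \ edgesTouching (↑K : Set (Fin n)) ∈ Q)) :
    ∫ ω in {ω | ∀ t ∈ T, ω ∉ openConn a t},
        (if ∀ v ∈ O, v = a ∨ ∃ e ∈ openEdgeCluster ω a, v ∈ e then (1 : ℝ) else 0) *
          (prodBernoulli w).real
            {ω' | ω' \ edgesTouching {v | v = a ∨ ∃ e ∈ openEdgeCluster ω a, v ∈ e} ∈ Q}
        ∂(prodBernoulli w) =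
      (prodBernoulli w).real ({ω | ∀ v ∈ O, ω ∈ openConn a v} ∩
        ({ω | ∀ t ∈ T, ω ∉ openConn a t} ∩ Q)) := by
  rw [setIntegral_eq_sum_clusterIs' (prodBernoulli w) a {ω | ∀ t ∈ T, ω ∉ openConn a t} _
      (fun K => (if (∀ v ∈ O, v ∈ K) then (1 : ℝ) else 0) *
        (prodBernoulli w).real {ω' | ω' \ edgesTouching (↑K : Set (Fin n)) ∈ Q})
      (fun K ω hω => by rw [F_openEdgeCluster' O hω, G_openEdgeCluster' w Q hω]),
    measureReal_eq_sum_clusterIs' (prodBernoulli w) a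
      ({ω | ∀ v ∈ O, ω ∈ openConn a v} ∩ ({ω | ∀ t ∈ T, ω ∉ openConn a t} ∩ Q))]
  refine Finset.sum_congr rfl fun K _ => ?_
  rw [inter_assoc, connAll_inter_inter_clusterIs']
  split_ifs with ho
  · rw [one_mul, real_disconn_inter_clusterIs_mul' w T a hQ]
  · simp

end Main

end GeneralTerminalSeparation

open GeneralTerminalSeparation in
/-- **General terminal separation (Kozma–Nitzan Lemma 1(i); BHK 2006 Thms 1.2–1.4), unconditional.**
For `μ = prodBernoulli w` on `Fin n`, a vertex `a`, vertex sets `T, O` and a finite set `P` of pairs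
each starting in `T`: with `E = {a ↔ v ∀ v ∈ O}`, `D = {a ↮ t ∀ t ∈ T}`, `Q = {t ↮ u ∀ (t,u) ∈ P}`,
`μ(E ∩ D) · μ(D ∩ Q) ≤ μ(D) · μ(E ∩ (D ∩ Q))`.
[cite: KozmaNitzan2024, Lemma 1(i) (p. 5); VandenbergHaggstromKahn2005, Thm. 1.3] -/
theorem terminalSeparation_general (w : Sym2 (Fin n) → unitInterval) (T O : Finset (Fin n))
    (a : Fin n) (P : Finset (Fin n × Fin n)) (hP : ∀ p ∈ P, p.1 ∈ T) :
    (prodBernoulli w).real ({ω | ∀ v ∈ O, ω ∈ openConn a v} ∩ {ω | ∀ t ∈ T, ω ∉ openConn a t}) *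
        (prodBernoulli w).real ({ω | ∀ t ∈ T, ω ∉ openConn a t} ∩
          {ω | ∀ p ∈ P, ω ∉ openConn p.1 p.2}) ≤
      (prodBernoulli w).real {ω | ∀ t ∈ T, ω ∉ openConn a t} *
        (prodBernoulli w).real ({ω | ∀ v ∈ O, ω ∈ openConn a v} ∩
          ({ω | ∀ t ∈ T, ω ∉ openConn a t} ∩ {ω | ∀ p ∈ P, ω ∉ openConn p.1 p.2})) := by
  by_cases haT : a ∈ T
  · -- `a ∈ T`: `{a ↮ T}` is empty and both sides vanish
    have hD : {ω : BondConfig (Fin n) | ∀ t ∈ T, ω ∉ openConn a t} = ∅ :=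
      Set.subset_empty_iff.1 fun ω hω => hω a haT (SimpleGraph.Reachable.refl a)
    simp [hD]
  · set Q : Set (BondConfig (Fin n)) := {ω | ∀ p ∈ P, ω ∉ openConn p.1 p.2}
    have hQ : ∀ (K : Finset (Fin n)) (ω : BondConfig (Fin n)), ω ∈ clusterIs a K →
        (∀ t ∈ T, t ∉ K) → (ω ∈ Q ↔ ω \ edgesTouching (↑K : Set (Fin n)) ∈ Q) :=
      fun K ω hω hTK => pairSep_iff_off_of_mem' hP hω hTK
    have hR : {ω : BondConfig (Fin n) | ∀ x ∈ (↑T : Set (Fin n)), ¬ (openGraph ω).Reachable a x} =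
        {ω | ∀ t ∈ T, ω ∉ openConn a t} := by
      ext ω; simp only [mem_setOf_eq, Finset.mem_coe]; rfl
    have key := BHK2006_clusterConditionalPositiveAssociation_holds (Fin n) w a (↑T : Set (Fin n))
      (fun W => if ∀ v ∈ O, v = a ∨ ∃ e ∈ W, v ∈ e then (1 : ℝ) else 0)
      (fun W => (prodBernoulli w).real {ω | ω \ edgesTouching {v | v = a ∨ ∃ e ∈ W, v ∈ e} ∈ Q})
      (monotone_F' a O) (monotone_G' w (isLowerSet_pairSep P) a)
      (fun h => haT (Finset.mem_coe.1 h))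
    rw [hR, setIntegral_F' w T O a, setIntegral_G' w T a hQ, setIntegral_F_mul_G' w T O a hQ] at key
    exact key

end Summit.CriticalPhenomena.PercolationContinuityZ3.Theorems
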